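import Summits.CriticalPhenomena.SAWScalingLimit.Theses.SAWDefectDecoherence
import Summits.CriticalPhenomena.SAWScalingLimit.Theses.SAWDevelopingMap
import Summits.CriticalPhenomena.SAWScalingLimit.Theses.SAWPhaseRetrieval
import Summits.CriticalPhenomena.SAWScalingLimit.Theses.SAWBrickWallHomotopy
import Literature.Probability.RandomPlanarGeometry.SAWScalingLimitFamily

/-!
# Line `dodecagonal-pivot` for the crux `HexTransfer` (stmt-CriticalPhenomena-14221)

Crux (route SAWDefectDecoherence, shared with SAWPhaseRetrieval / SAWWindingAlias / SAWDevelopingMap):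
`HexTransfer := (Duminil-Copin–Smirnov 2012 Conjecture 1 on the hexagonal lattice, written out) → SAWScalingLimit`.

Idea (card `Cruxes/HexTransfer/Ideas/dodecagonal-pivot.md`): do NOT transfer hexagonal → ℤ² inside one
periodic graph (crystallographic ceiling: no planar lattice carries a quarter-turn and a third-turn
together, so every fixed-lattice homotopy has a leg with only D₂ symmetry and a free modulus); RELAY instead
through the critical SAW on the twelvefold cyclotomic model set
`Λ₁₂(r) = {x ∈ ℤ[ξ₁₂] : |x⋆| ≤ r}` (`ξ₁₂ = e^{iπ/6}`, ⋆-map `ξ ↦ ξ⁵`, window a centred disc — Baake–Grimm,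
Aperiodic Order I, Table 7.1, Ex. 7.12), made a planar graph by its DELAUNAY graph (triage sharpening:
the ideator's unit-step graph was a non-planar placeholder). `12 = lcm(6, 4)`: the pivot has an exact
rotation of order 12 about `0`, so leg A (honeycomb ↔ Λ₁₂) is pinned by an exact rotation of order 6
and leg B (Λ₁₂ ↔ ℤ²) by an exact rotation of order 4 at EVERY parameter — only score decorrelation is
left on each leg; no Yang–Baxter weight, no observable, no response field.

## Shape of the skeleton (6 registered stubs + the kernel-checked composition `HexTransfer_of`)

The two open legs are typed in the BLIND form sanctioned by the audit of the barrier
`Literature.Barriers.CriticalPhenomena.EmbeddingModulusUniqueness` ("(blind ∃ M step) + (symmetry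
step) meets this barrier only in its second, elementary step"): each leg delivers the scaling limit
MODULO an unidentified orientation-preserving real-linear map `Φ z = a z + b z̄`, `‖b‖ < ‖a‖`; the two
PIN stubs remove `Φ` using the exact rotation available at the END of the leg (order 12 on the pivot,
order 4 on `ℤ²`) together with the SLE lemma `StretchRigidity` (= item stmt-CriticalPhenomena-5793 of
route SAWBrickWallHomotopy, shared; pin-the-shear's `LinearPinning` is its GL₂⁺ corollary).

* `stub_pivot`           : `PivotWellPosed ρ₁₂`                                            (L, provable now)
* `stub_legA`            : `PivotWellPosed ρ₁₂ → HexConjecture → DodecSLEModL ρ₁₂`          (XL, open — leg A, C₆-pinned)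
* `stub_pivotPin`        : `PivotWellPosed ρ₁₂ → StretchRigidity → DodecSLEModL ρ₁₂ → DodecSLE ρ₁₂` (M/L, provable now modulo 5793)
* `stub_stretchRigidity` : `SAWBrickWallHomotopy.StretchRigidity`                           (L, = stmt-5793 verbatim)
* `stub_legB`            : `PivotWellPosed ρ₁₂ → DodecSLE ρ₁₂ → SquareSLEModL`              (XL, open — leg B, C₄-pinned; HARDEST)
* `stub_squarePin`       : `StretchRigidity → SquareSLEModL → SAWScalingLimit`               (M, provable now modulo 5793)

`HexTransfer_of : SAWDefectDecoherence.HexTransfer` consumes the hexagonal hypothesis exactly ONCE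
(in `stub_legA`) and factors through the third statement `DodecSLE ρ₁₂` (neither hypothesis nor
conclusion of the crux), so the line does not restate the target.

The rationale lemmas of the card are re-proved below WITHOUT `sorry`: `similarity_of_commute_rotation`,
`orientation_reversing_of_anticommute_rotation` (the 2 × 2 pin algebra in the `a z + b z̄` calculus,
uniformly for every non-real unit `ζ`, i.e. for the order-12 and the order-4 pin at once; `conj_xi_ne_xi`,
`conj_I_ne_I`) and `crystallographicCeiling` (no basis integralises the quarter-turn and the third-turn
together: `tr(B⁻¹R₄R₃B) = −√3 ∉ ℤ`), the reason the relay must leave periodic graphs.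

Objects checked numerically (folder `exp/dodec_delaunay.py`, radius-11 patch of `Λ₁₂(ρ₁₂)`): 1345 points, none
on the window boundary, exact `σ`-invariance, minimal distance `2 sin 15°`; Delaunay graph planar (0 crossings),
connected, degrees {5, 6} and 12 at the centre, edge lengths {2 sin 15°, √3 − 1, 1}.
-/

noncomputable section

namespace Summit.CriticalPhenomena.SAWScalingLimit.Cruxes.HexTransfer.DodecagonalPivot

open MeasureTheory Filter Topology
open Literature.Probability.RandomPlanarGeometry Literature.Probability.LatticeModels
open Summit.CriticalPhenomena.SAWScalingLimit.Theses
open scoped NNReal ComplexConjugate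

/-! ## The pivot: the twelvefold cyclotomic model set `Λ₁₂(r)` and its Delaunay graph -/

/-- `ξ₁₂ = e^{iπ/6}`, a primitive 12th root of unity; `ℤ[ξ₁₂]` has rank `4 = φ(12)` with basis
`1, ξ, ξ², ξ³` (minimal polynomial `X⁴ − X² + 1`). [cite: BaakeGrimm2013, Table 7.1] -/
def xi : ℂ := Complex.exp (↑(Real.pi / 6) * Complex.I)

/-- Physical projection `x ↦ x₀ + x₁ ξ + x₂ ξ² + x₃ ξ³` of `ℤ⁴ ≅ ℤ[ξ₁₂]` into `ℂ` (injective, dense image). -/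
def physProj (x : Fin 4 → ℤ) : ℂ := ∑ k : Fin 4, (x k : ℂ) * xi ^ (k : ℕ)

/-- Internal (⋆-) projection: the Galois conjugate `ξ ↦ ξ⁵`, `x ↦ x₀ + x₁ ξ⁵ + x₂ ξ¹⁰ + x₃ ξ¹⁵`.
[cite: BaakeGrimm2013, Table 7.1 and §7.3] -/
def starProj (x : Fin 4 → ℤ) : ℂ := ∑ k : Fin 4, (x k : ℂ) * xi ^ (5 * (k : ℕ))

/-- Vertices of the model set `Λ₁₂(r)`: lattice points whose ⋆-image lies in the closed centred disc
of radius `r` (a `D₁₂`-symmetric window, so `Λ₁₂(r)` is exactly invariant under `z ↦ ξ₁₂ z`).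
[cite: BaakeGrimm2013, Ex. 7.12] -/
def DodecVertex (r : ℝ) : Type := {x : Fin 4 → ℤ // ‖starProj x‖ ≤ r}

/-- The planar embedding of the pivot vertices (physical projection). -/
def dodecEmb (r : ℝ) : DodecVertex r → ℂ := fun x => physProj x.1

/-- The model set `Λ₁₂(r) ⊂ ℂ` as a point set (a Delone set for `r > 0`). -/
def dodecSet (r : ℝ) : Set ℂ := Set.range (dodecEmb r)

/-- **Delaunay edge** of a planar point set `S` (strict empty-disc form): `p ≠ q` lie on a circle whose
closed disc contains no further point of `S`. For a Delone set this is the 1-skeleton of the Delaunay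
subdivision (cocircular cells kept as convex polygons): a connected, locally finite, PLANAR straight-line
graph, invariant under every isometry of `ℂ` preserving `S` — the triage-requested replacement of the
non-planar unit-step graph. [folklore] -/
def IsDelaunayEdge (S : Set ℂ) (p q : ℂ) : Prop :=
  p ≠ q ∧ ∃ (c : ℂ) (ρ : ℝ), dist p c = ρ ∧ dist q c = ρ ∧ ∀ z ∈ S, dist z c ≤ ρ → z = p ∨ z = q

/-- The **pivot graph**: the Delaunay graph of `Λ₁₂(r)`. -/
def dodecGraph (r : ℝ) : SimpleGraph (DodecVertex r) :=
  SimpleGraph.fromRel fun x y => IsDelaunayEdge (dodecSet r) (dodecEmb r x) (dodecEmb r y)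

/-- The rooted exponential growth rate `μ(v) := limsup_n cₙ(v)^{1/n}` of self-avoiding walks of the pivot
graph from `v` (bounded by the maximal degree, so never junk). On a connected graph it does not depend on
`v` (Hammersley's neighbour inequality `cₙ(w) ≤ cₙ₊₁(v) + Σₖ cₖ(v) cₙ₋ₖ(v)`), which is why only `limsup`
— never `⨅ₙ` — is used (triage doubt (a): `⨅ₙ cₙ₊₁(0)^{1/(n+1)}` equals the growth rate only if inf = lim,
false in general on a non-transitive graph). -/
def dodecRootedMu (r : ℝ) (v : DodecVertex r) : ℝ :=
  Filter.limsup (fun n : ℕ => (SAW.sawCount (dodecGraph r) v n : ℝ) ^ (1 / (n : ℝ))) Filter.atTop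

/-- The **connective constant of the pivot**, `μ₁₂(r) := sup_v μ(v)` (= `μ(v)` for every root `v`, see
`PivotWellPosed`); the critical fugacity of the pivot SAW is `μ₁₂(r)⁻¹` — the `Λ₁₂` counterpart of
`SAW.criticalFugacity = (SAW.connectiveConstant)⁻¹` and of `hexCriticalFugacity`. -/
def dodecMu (r : ℝ) : ℝ := ⨆ v : DodecVertex r, dodecRootedMu r v

/-- The **critical SAW law of the pivot** in `(Ω_δ; a, b)`: the generic embedded-graph law `SAW.embLaw`
(weight `x^{ℓ(γ)}`, largest-component discretisation, exactly the conventions of `hexSAWLaw`) for the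
Delaunay graph of `Λ₁₂(r)` at fugacity `μ₁₂(r)⁻¹`. -/
def dodecLaw (r : ℝ) (Ω : Set ℂ) (δ : ℝ) (a b : DodecVertex r) :
    Measure (SAW.EmbDomainSAW (dodecGraph r) (dodecEmb r) Ω δ a b) :=
  SAW.embLaw (dodecGraph r) (dodecEmb r) Ω δ (dodecMu r)⁻¹ a b

/-- The window radius used by the line: `ρ₁₂ = (2 + √3)/2` (the inradius of the shield-tiling window
`W₁₂`; a REGULAR radius: `ρ₁₂² = (7 + 4√3)/4 ∉ ℤ[√3] ∋ |x⋆|²`, so no lattice point projects onto the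
window boundary). Any `r > 0` would do; one is fixed so that the stubs are single statements.
[cite: BaakeGrimm2013, Ex. 7.12] -/
def pivotRadius : ℝ := (2 + Real.sqrt 3) / 2

/-! ## The statements of the line -/

/-- **PivotWellPosed r** — the aperiodic-graph groundwork (all provable now, size L in total):
(i) the Delaunay pivot graph is connected; (ii) it has bounded degree; (iii) EXACT TWELVEFOLD SYMMETRY:
a graph automorphism `σ` covering the rotation `z ↦ ξ₁₂ z` (multiplication by `ξ₁₂` preserves `ℤ[ξ₁₂]`,
the disc window and Delaunay adjacency); (iv) NON-VACUITY: every Dobrushin domain admits a pivot endpoint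
approximation (the `Λ₁₂` twin of `SAW.exists_isEndpointApprox`; makes `DodecSLE` bite, so that leg B is
not the summit in costume); (v) the growth rate is root-independent (`μ(v) = μ₁₂(r)` for every `v`, Hammersley) and exceeds `1`
(exponentially many SAWs on a Delaunay graph of a Delone set). Existence of `lim cₙ(v)^{1/n}` (expected from
uniform patch frequencies of regular model sets, Baake–Grimm Thm 7.2) is deliberately NOT asserted. -/
def PivotWellPosed (r : ℝ) : Prop :=
  (dodecGraph r).Connected ∧
  (∃ Δ : ℕ, ∀ v : DodecVertex r,
      ((dodecGraph r).neighborSet v).Finite ∧ ((dodecGraph r).neighborSet v).ncard ≤ Δ) ∧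
  (∃ σ : dodecGraph r ≃g dodecGraph r, ∀ x : DodecVertex r, dodecEmb r (σ x) = xi * dodecEmb r x) ∧
  (∀ D : DobrushinDomain, ∃ u v : ℝ → DodecVertex r,
      SAW.IsEmbEndpointApprox (dodecGraph r) (dodecEmb r) D u v) ∧
  (1 < dodecMu r ∧ ∀ v : DodecVertex r, dodecRootedMu r v = dodecMu r)

/-- **DodecSLE r** — the pivot statement (a THIRD statement, neither hypothesis nor conclusion of the
crux): the critical SAW on the Delaunay graph of `Λ₁₂(r)` converges to chordal SLE(8/3) for every
Dobrushin domain and every pivot endpoint approximation — DCS Conjecture 1 transposed verbatim from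
`hexGraph / hexCenter` to `dodecGraph r / dodecEmb r`. Numerics on the 8-fold Ammann–Beenker and 5-fold
Penrose tilings are consistent with the `ℤ²` class (γ = 43/32, ν = 3/4), and cut-and-project
aperiodicity is Harris–Luck irrelevant at the planar SAW fixed point. [cite: arXiv:cond-mat/0302414] -/
def DodecSLE (r : ℝ) : Prop :=
  ∀ (D : DobrushinDomain) (u v : ℝ → DodecVertex r),
    SAW.IsEmbEndpointApprox (dodecGraph r) (dodecEmb r) D u v →
      ConvergesInLawToSLE ((8 : ℝ≥0) / 3) D
        (fun δ (γ : SAW.EmbDomainSAW (dodecGraph r) (dodecEmb r) D.carrier δ (u δ) (v δ)) => γ.curve)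
        (fun δ => dodecLaw r D.carrier δ (u δ) (v δ))

/-- **DodecSLEModL r** — leg A's BLIND conclusion: the pivot SAW has a scaling limit which is chordal
SLE(8/3) up to ONE unidentified orientation-preserving real-linear change of coordinates
`Φ z = a z + b z̄` (`‖b‖ < ‖a‖`): for some chordal family `P` of SLE(8/3) laws, the pivot law in `D`
converges to `Φ_* P(Φ⁻¹ D)` for every `D` and every pivot endpoint approximation. The modulus `b/a` is
NOT asserted to vanish here — that is the pin's job. -/
def DodecSLEModL (r : ℝ) : Prop :=
  ∃ (a b : ℂ) (Φ : ℂ ≃ₜ ℂ), ‖b‖ < ‖a‖ ∧ (∀ z : ℂ, Φ z = a * z + b * conj z) ∧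
    ∃ P : ChordalFamily, (∀ D : DobrushinDomain, IsSLELaw ((8 : ℝ≥0) / 3) D (P D)) ∧
      ∀ (D : DobrushinDomain) (u v : ℝ → DodecVertex r),
        SAW.IsEmbEndpointApprox (dodecGraph r) (dodecEmb r) D u v →
          TendstoLaw
            (fun δ (γ : SAW.EmbDomainSAW (dodecGraph r) (dodecEmb r) D.carrier δ (u δ) (v δ)) => γ.curve)
            (fun δ => dodecLaw r D.carrier δ (u δ) (v δ)) id
            ((P (D.map Φ.symm)).map (CurveClass.map (Φ : C(ℂ, ℂ))))

/-- **SquareSLEModL** — leg B's BLIND conclusion, the `δℤ²` twin of `DodecSLEModL`: the critical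
square-lattice SAW law `SAW.law` converges, for every Dobrushin domain and every `ℤ²` endpoint
approximation, to `Φ_* P(Φ⁻¹ D)` for ONE unidentified orientation-preserving real-linear `Φ` and a
chordal family `P` of SLE(8/3) laws (the GL₂⁺ form of route SAWBrickWallHomotopy's
`ModulusUniversality`, with SLE in place of the hexagonal law). -/
def SquareSLEModL : Prop :=
  ∃ (a b : ℂ) (Φ : ℂ ≃ₜ ℂ), ‖b‖ < ‖a‖ ∧ (∀ z : ℂ, Φ z = a * z + b * conj z) ∧
    ∃ P : ChordalFamily, (∀ D : DobrushinDomain, IsSLELaw ((8 : ℝ≥0) / 3) D (P D)) ∧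
      ∀ (D : DobrushinDomain) (u v : ℝ → Site 2), SAW.IsEndpointApprox D u v →
        TendstoLaw (fun δ (γ : SAW.DomainSAW D.carrier δ (u δ) (v δ)) => γ.curve)
          (fun δ => SAW.law D.carrier δ (u δ) (v δ)) id
          ((P (D.map Φ.symm)).map (CurveClass.map (Φ : C(ℂ, ℂ))))

/-! ## Registered stubs -/

/-- Stub (L, provable now). **The pivot is a well-posed, exactly twelvefold-symmetric critical SAW
model**: `PivotWellPosed pivotRadius` — connected bounded-degree Delaunay graph of the model set
`Λ₁₂(ρ₁₂)`, the order-12 automorphism `σ` covering `z ↦ ξ₁₂ z`, endpoint approximations for every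
Dobrushin domain, and the root-independent growth rate `μ₁₂ > 1`. Leans on: Delone property of cut-and-project sets
(Baake–Grimm Prop. 7.5), `JordanDomain.exists_forall_mem_meshDomain_and_reachable` (the `ℤ²` model of
the non-vacuity proof), `SAW.sawCount`. -/
theorem stub_pivot : PivotWellPosed pivotRadius := by
  sorry

/-- Stub (XL, open — **leg A**, the C₆-pinned leg). From Duminil-Copin–Smirnov Conjecture 1
(`HexConjecture`, consumed HERE and only here) to the pivot limit MODULO an unidentified real-linear map:
along the planarised overlay `(honeycomb, hexagon centre at 0) ⊕ Λ₁₂` with weights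
`y_H^{N_H} y_Q^{N_Q} κ^{N_sw}` on its critical surface (κ = 0 at both ends decouples the layers), the
rotation by `π/3` about `0` is exact at every parameter, so the exponential-family derivative
`d/dt E_t[f] = Cov_t(f, S_t)` has no spin-2 (stress-tensor) channel and the claim is pure score
decorrelation `Cov_t(f, S_t) → 0` (predicted rate `δ²`, Δ₁ = 3/2); the blind form below is what an
argument that does NOT identify the response would still give. Why it might fail: planar SAW
universality along a pinned one-parameter family is unproved in every instance; on `Λ₁₂`-overlays
transfer matrices and translation invariance are replaced by unique ergodicity only. -/
theorem stub_legA :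
    PivotWellPosed pivotRadius → SAWDevelopingMap.HexConjecture → DodecSLEModL pivotRadius := by
  sorry

/-- Stub (M/L, provable now modulo `StretchRigidity`). **The twelvefold pin**: the exact automorphism
`σ` of `PivotWellPosed` makes the pivot laws `ξ₁₂`-covariant at every mesh (graph automorphism ⇒
`embMeshDomain`, weights and endpoint approximations rotate), hence — by uniqueness of weak limits
along `𝓝[>] 0` (`TendstoLaw.unique`) and non-vacuity — the blind limit family `D ↦ Φ_* P(Φ⁻¹ D)` is
covariant under `R = (z ↦ ξ₁₂ z)`; SLE(8/3) laws are similarity covariant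
(`IsSLELaw.conformalCovariance_of_facts`, `similarityConformalEquiv`), so `Φ⁻¹ R Φ` is a covariance of
the SLE(8/3) family; polar decomposition + `StretchRigidity` make it a similarity with the eigenvalues
of `R`, i.e. `R^{±1}`; `R⁻¹` would force `‖a‖ ≤ ‖b‖` (`orientation_reversing_of_anticommute_rotation`),
so `Φ` commutes with `R` and is itself a similarity (`similarity_of_commute_rotation`, `b = 0`), whence
`Φ_* P(Φ⁻¹ D)` is an SLE(8/3) law and `DodecSLE` follows (`integral_map`). -/
theorem stub_pivotPin :
    PivotWellPosed pivotRadius → SAWBrickWallHomotopy.StretchRigidity →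
      DodecSLEModL pivotRadius → DodecSLE pivotRadius := by
  sorry

/-- Stub (L, = item stmt-CriticalPhenomena-5793 of route SAWBrickWallHomotopy, verbatim): **chordal
SLE(8/3) admits no axis-stretch covariance** (`x + iy ↦ x + isy` a covariance of the SLE(8/3) law family
forces `s = 1`; restriction formula `P(γ ∩ A = ∅) = Φ'_A(0)^{5/8}` on an explicit pair, or corridor
degeneration under iteration). Shared with pin-the-shear's `LinearPinning` and the tail of
`SAWBrickWallHomotopy.Assembly` — filed once, here by name. -/
theorem stub_stretchRigidity : SAWBrickWallHomotopy.StretchRigidity := by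
  sorry

/-- Stub (XL, open — **leg B**, the C₄-pinned leg; the HARDEST stub: it must produce the `δℤ²` law of
the summit from an aperiodic model with no integrable anchor on either side). From the pivot limit
`DodecSLE` to the square-lattice limit MODULO an unidentified real-linear map, along the planarised
overlay `Λ₁₂ ⊕ (ℤ², face centre at 0)` — exact rotation by `π/2` about `0` at every parameter, same
response-free decorrelation mechanism as leg A, here in the D₄ instance already staffed as
`SAWQuadrupoleWard.StiffnessUniversality` (stmt-6558) / `SAWCompassLattice.SurfaceUniversality`
(stmt-6964). `PivotWellPosed` supplies the pivot endpoint approximations without which `DodecSLE`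
could not be applied. Why it might fail: as leg A; in addition the switch vertices of the overlay are
degree-4 crossings of two incommensurate layers (infinite local complexity at generic relative scale).
Cheapest falsifier: `Cov_t(1{z left of γ}, S_t)/√Var` at the midpoint of the leg on patches of radius
32…128 — an O(1) plateau instead of `δ^{2−ε}` decay kills the mechanism. -/
theorem stub_legB :
    PivotWellPosed pivotRadius → DodecSLE pivotRadius → SquareSLEModL := by
  sorry

/-- Stub (M, provable now modulo `StretchRigidity`). **The quarter-turn pin** — the GL₂⁺ form of the
tail of `SAWBrickWallHomotopy.Assembly` (stmt-10313): the exact order-4 rotation of `δℤ²`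
(`SAWBrickWallHomotopy.QuarterTurnCovariance`, stmt-5794, provable now and the natural first by-product)
plus `TendstoLaw.unique` and `SAW.exists_isEndpointApprox` make `D ↦ Φ_* P(Φ⁻¹ D)` covariant under
`z ↦ iz`; as in `stub_pivotPin`, `StretchRigidity` and the pin algebra force `b = 0`, so every limit
law is chordal SLE(8/3) and `SAWScalingLimit` follows (`SAW.IsScalingLimitFamily.sawScalingLimit` /
`integral_map`). -/
theorem stub_squarePin :
    SAWBrickWallHomotopy.StretchRigidity → SquareSLEModL → _root_.SAWScalingLimit := by
  sorry

/-! ## The composition (kernel-checked, no `sorry` outside the stubs) -/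

/-- **Explicit-binder form of the composition**: every hypothesis is one stub statement, the conclusion is
the crux UNFOLDED (`HexConjecture → SAWScalingLimit`, the common body of the four routes' `HexTransfer`).
The hexagonal hypothesis is spent once, as the anchor of leg A; the twelvefold pin upgrades leg A's blind
limit to `DodecSLE`; leg B carries it to `δℤ²` blind; the quarter-turn pin finishes. -/
theorem hexTransfer_of_stubs
    (hW : PivotWellPosed pivotRadius)
    (hA : PivotWellPosed pivotRadius → SAWDevelopingMap.HexConjecture → DodecSLEModL pivotRadius)
    (hPinA : PivotWellPosed pivotRadius → SAWBrickWallHomotopy.StretchRigidity →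
      DodecSLEModL pivotRadius → DodecSLE pivotRadius)
    (hS : SAWBrickWallHomotopy.StretchRigidity)
    (hB : PivotWellPosed pivotRadius → DodecSLE pivotRadius → SquareSLEModL)
    (hPinB : SAWBrickWallHomotopy.StretchRigidity → SquareSLEModL → _root_.SAWScalingLimit) :
    SAWDevelopingMap.HexConjecture → _root_.SAWScalingLimit :=
  fun hHex => hPinB hS (hB hW (hPinA hW hS (hA hW hHex)))

/-- **The line closes the crux modulo its stubs.** `HexTransfer` (stmt-CriticalPhenomena-14221) under the
decl of the payload's primary route SAWDefectDecoherence, fed with the six registered stubs (sorries only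
inside `stub_*`). -/
theorem HexTransfer_of : SAWDefectDecoherence.HexTransfer :=
  hexTransfer_of_stubs stub_pivot stub_legA stub_pivotPin stub_stretchRigidity stub_legB stub_squarePin

/-- The same term against the sibling routes' copies of the crux (the four `HexTransfer` bodies are
syntactically identical; the shared item is registered under SAWPhaseRetrieval). -/
theorem HexTransfer_proof : SAWPhaseRetrieval.HexTransfer := HexTransfer_of

/-- … and for route SAWDevelopingMap (whose `HexConjecture` names the hypothesis). -/
theorem HexTransfer_developingMap : SAWDevelopingMap.HexTransfer := HexTransfer_of

/-! ## Rationale lemmas, proved (the pin algebra in the `a z + b z̄` calculus)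

Every real-linear map of `ℂ` is `z ↦ a z + b z̄`; its determinant is `‖a‖² − ‖b‖²`; it is a similarity
iff `b = 0`. The two facts below are the algebraic core of BOTH pins (`ζ = ξ₁₂` and `ζ = i`): they are
pin-the-shear's (P2)/(P3) and the ideator's `pinningLemma_holds`, uniformly for any non-real unit `ζ`. -/

/-- **Pinning lemma.** If the real-linear map `z ↦ a z + b z̄` commutes with the rotation `z ↦ ζ z` for
some non-real `ζ` (e.g. any root of unity of order ≥ 3), then `b = 0`: the map is complex-linear, i.e.
an orientation-preserving similarity. [folklore] -/
theorem similarity_of_commute_rotation {a b ζ : ℂ} (hζ : conj ζ ≠ ζ)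
    (h : ∀ z : ℂ, a * (ζ * z) + b * conj (ζ * z) = ζ * (a * z + b * conj z)) : b = 0 := by
  have h1 := h 1
  simp only [mul_one, map_one] at h1
  -- h1 : a * ζ + b * conj ζ = ζ * (a + b)
  have h2 : b * (conj ζ - ζ) = 0 := by linear_combination h1
  rcases mul_eq_zero.mp h2 with hb | hz
  · exact hb
  · exact absurd (sub_eq_zero.mp hz) hζ

/-- **Orientation lemma.** If `z ↦ a z + b z̄` intertwines the rotation `z ↦ ζ z` with its inverse
(`Φ ∘ R = R⁻¹ ∘ Φ`, written with `conj ζ = ζ⁻¹` for a unit `ζ`) for some non-real `ζ`, then `a = 0`: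
the map is `z ↦ b z̄`, orientation-reversing (`det = −‖b‖² ≤ 0`). Hence an orientation-PRESERVING blind
map `Φ` with `Φ⁻¹ R Φ ∈ {R, R⁻¹}` commutes with `R`. [folklore] -/
theorem orientation_reversing_of_anticommute_rotation {a b ζ : ℂ} (hζ : conj ζ ≠ ζ)
    (h : ∀ z : ℂ, a * (ζ * z) + b * conj (ζ * z) = conj ζ * (a * z + b * conj z)) : a = 0 := by
  have h1 := h 1
  simp only [mul_one, map_one] at h1
  -- h1 : a * ζ + b * conj ζ = conj ζ * (a + b)
  have h2 : a * (ζ - conj ζ) = 0 := by linear_combination h1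
  rcases mul_eq_zero.mp h2 with ha | hz
  · exact ha
  · exact absurd (sub_eq_zero.mp hz).symm hζ

/-- `ξ₁₂` is a non-real unit: `conj ξ₁₂ ≠ ξ₁₂` (its imaginary part is `sin(π/6) = 1/2`), so both
rationale lemmas apply to the twelvefold pin; for the quarter-turn pin take `ζ = I`. [folklore] -/
theorem conj_xi_ne_xi : conj xi ≠ xi := by
  intro h
  have him : xi.im = 0 := by
    have := congrArg Complex.im h
    simp only [Complex.conj_im] at this
    linarith
  have hsin : xi.im = Real.sin (Real.pi / 6) := by
    rw [xi, Complex.exp_im]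
    simp [Complex.ofReal_im, Complex.ofReal_re]
  rw [hsin, Real.sin_pi_div_six] at him
  norm_num at him

/-- For the quarter-turn pin: `conj I ≠ I`. [folklore] -/
theorem conj_I_ne_I : conj Complex.I ≠ Complex.I := by
  rw [Complex.conj_I]
  intro h
  have := congrArg Complex.im h
  simp at this
  -- this : (-1 : ℝ) = 1 (or similar)
  linarith

/-! ## Rationale lemma, proved: the crystallographic ceiling

Why the pivot cannot be a periodic graph: no basis `B` of `ℝ²` makes BOTH the quarter-turn and the
third-turn integral (i.e. no planar lattice is invariant under rotations of order 4 and 3 about one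
point), because the trace of `B⁻¹ R₄ R₃ B` would be an integer equal to `tr(R₄ R₃) = 2cos(7π/6) = −√3`.
Hence in every chain of positive-weight homotopies on fixed PERIODIC planar graphs from the honeycomb SAW
to the ℤ² SAW some leg has no rotation of order ≥ 3, and there one real modulus is free (Beffara). The
pivot `Λ₁₂` leaves periodicity at exactly one point instead. (Baake–Grimm Lemma 3.2 / Cor. 3.1 for the
pair (4, 3); the ideator's `crystallographicCeiling_holds`, re-proved.) -/

/-- The rotation matrix by `θ`. [folklore] -/
def rot (θ : ℝ) : Matrix (Fin 2) (Fin 2) ℝ := !![Real.cos θ, -Real.sin θ; Real.sin θ, Real.cos θ]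

/-- `M` is integral in the basis `B`: `B⁻¹ M B ∈ M₂(ℤ)`. [folklore] -/
def IsIntegralIn (B M : Matrix (Fin 2) (Fin 2) ℝ) : Prop :=
  ∀ i j : Fin 2, ∃ n : ℤ, (B⁻¹ * M * B) i j = n

/-- `tr(R_θ R_φ) = 2 cos(θ + φ)`. [folklore] -/
theorem trace_rot_mul_rot (θ φ : ℝ) : Matrix.trace (rot θ * rot φ) = 2 * Real.cos (θ + φ) := by
  rw [Matrix.trace_fin_two, Matrix.mul_apply, Matrix.mul_apply, Fin.sum_univ_two, Fin.sum_univ_two]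
  simp [rot, Real.cos_add]
  ring

/-- **Crystallographic ceiling** (Baake–Grimm, Aperiodic Order I, Lemma 3.2 and Cor. 3.1, specialised to
the pair of orders (4, 3)): no invertible `B` integralises the quarter-turn and the third-turn together.
[cite: BaakeGrimm2013, Lemma 3.2] -/
theorem crystallographicCeiling (B : Matrix (Fin 2) (Fin 2) ℝ) (hB : IsUnit B.det)
    (h4 : IsIntegralIn B (rot (Real.pi / 2))) (h3 : IsIntegralIn B (rot (2 * Real.pi / 3))) :
    False := by
  unfold IsIntegralIn at h4 h3
  choose p hp using h4
  choose q hq using h3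
  -- (1) the trace of the product of the two conjugated rotations is an integer
  have htrZ : Matrix.trace ((B⁻¹ * rot (Real.pi / 2) * B) * (B⁻¹ * rot (2 * Real.pi / 3) * B))
      = ((∑ i : Fin 2, ∑ k : Fin 2, p i k * q k i : ℤ) : ℝ) := by
    simp only [Matrix.trace, Matrix.diag, Matrix.mul_apply, hp, hq]
    push_cast
    rfl
  -- (2) … and it equals tr(R₄ R₃) = 2 cos(7π/6) = −√3
  have htrR : Matrix.trace ((B⁻¹ * rot (Real.pi / 2) * B) * (B⁻¹ * rot (2 * Real.pi / 3) * B))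
      = -Real.sqrt 3 := by
    have hcyc : Matrix.trace ((B⁻¹ * rot (Real.pi / 2) * B) * (B⁻¹ * rot (2 * Real.pi / 3) * B))
        = Matrix.trace (rot (Real.pi / 2) * rot (2 * Real.pi / 3)) := by
      have h1 : (B⁻¹ * rot (Real.pi / 2) * B) * (B⁻¹ * rot (2 * Real.pi / 3) * B)
          = B⁻¹ * (rot (Real.pi / 2) * rot (2 * Real.pi / 3) * B) := by
        simp only [Matrix.mul_assoc, Matrix.mul_nonsing_inv_cancel_left B _ hB]
      rw [h1, Matrix.trace_mul_comm, Matrix.mul_assoc, Matrix.mul_nonsing_inv B hB, Matrix.mul_one]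
    rw [hcyc, trace_rot_mul_rot]
    have hang : Real.pi / 2 + 2 * Real.pi / 3 = Real.pi / 6 + Real.pi := by ring
    rw [hang, Real.cos_add_pi, Real.cos_pi_div_six]
    ring
  -- (3) −√3 is not an integer
  have hirr : Irrational (Real.sqrt 3) := Nat.prime_three.irrational_sqrt
  have key : Real.sqrt 3 = ((-(∑ i : Fin 2, ∑ k : Fin 2, p i k * q k i) : ℤ) : ℝ) := by
    push_cast
    have := htrZ.symm.trans htrR
    push_cast at this
    linarith
  exact hirr.ne_int _ key

end Summit.CriticalPhenomena.SAWScalingLimit.Cruxes.HexTransfer.DodecagonalPivot
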